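import Summits.QuantumAdvantage.QuantumAdvantage.Theorems.AnchorDialDatumM

/-!
# AnchorDial — part 25 «ShellM» (cell decomp-qadv, seat lens-2, generation 15; supports item 26531 `ExactnessDial.PolyLossOddU3`)

§H of the g15 node «GaugeDial»: the COUNTING SHELL for `m` anchors and `F` flip sites.  `ZM δ` (sign vectors
compatible with the table of SOME gauge), `card_ZM_le` (≤ `6^m(1+F+C(F,2))`), `full_memM` (a good odd input winning
along its whole orbit has `zvecF b x ∈ ZM (datM … x)` — the gauge orbit law at the TRUE gauge), `card_big_leF`, and
`count_shellM`: `2^{F+1}·#odd ≤ 6^m(1+F+C(F,2))·2^N + junk + 2^{F+1}·(2^F·#losers + #non-unique + 2^F·Σ instability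
+ #straddle + 2^F·#not-near)` given equidistribution of `zvecF` on the classes of the datum.  Namespace `…Theorems.AnchorDial`; imports part 24.  Verbatim from the node file; no `sorry`, no `native_decide`, no instances/notation; lint-clean without the unusedVariables switch.
-/

set_option linter.dupNamespace false

/-! ## §H  The COUNTING SHELL for `m` anchors and `F` flip sites -/

noncomputable section

open scoped Classical

namespace Summit.QuantumAdvantage.QuantumAdvantage.Theorems.AnchorDial

open Finset
open Literature.Computability.QuantumComplexity Literature.Computability.QuantumComplexity.RingHLF
open Literature.Computability.MetaComplexity Literature.Computability.MetaComplexity.Smolensky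
open Summit.QuantumAdvantage.AdviceFreeQNC0
open Summit.QuantumAdvantage.QuantumAdvantage.Theorems.HolonomyDial (gCond selP selP_mem selP_apply indP indP_mem indP_apply)

variable {N : ℕ}

section ShellM

variable {F m : ℕ}

/-- the set `Z(δ)` of site-parity vectors avoiding (at `τ = 0`) the tables of SOME gauge. -/
def ZM (δ : (Fin m → ZMod 3 × Bool) → (Fin F → Bool) → ZMod 3) : Finset (Fin F → Bool) :=
  univ.filter fun σ => ∃ g, CoreF.AvoidsF (δ g) σ 0

/-- AnchorDialShellM helper `card_ZM_le` (decomp-qadv land package; see the module docstring). -/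
theorem card_ZM_le (hF : 4 ≤ F) (δ : (Fin m → ZMod 3 × Bool) → (Fin F → Bool) → ZMod 3) :
    (ZM δ).card ≤ 6 ^ m * (1 + F + F.choose 2) := by
  have h := CoreF.card_exists_avoidsF_le hF δ
  rwa [card_gauge] at h

/-- **GOOD inputs have a compatible site-parity vector** (the orbit law `gauge_orbit_avoids` read through the
faithful datum `datM`): on an odd input whose `m` anchor sets are singletons `{k_j}` all along the `2^F`-orbit, each
window on one side of the flip region, deviations `r`-near the anchors and the strategy winning all along the orbit,
`zvecF b x ∈ Z(datM x)`. -/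
theorem full_memM (hN : 3 ≤ N) (j₀ : Fin m) (P : Fin N → CubeFn (ZMod 3) N)
    (A : Fin m → Fin N → CubeFn (ZMod 3) N) (r : ℕ) {b : Fin F → ℕ}
    (hb : ∀ i j : Fin F, i < j → b i + 2 ≤ b j) (hbN : ∀ i, b i + 3 ≤ N) (x : Fin N → Bool) (hx : OddZeros x)
    (kv : Fin m → Fin N) (hanc : ∀ ε j, anc (A j) (orbF b ε x) = {kv j})
    (hside : ∀ j, (∀ i, (kv j).val + r < b i) ∨ (∀ i, b i + 1 ≤ (kv j).val))
    (hnear : ∀ ε, ∀ q ∈ dev P (orbF b ε x), ∃ j, (kv j).val ≤ q.val ∧ q.val ≤ (kv j).val + r)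
    (hwin : ∀ ε, Rel (orbF b ε x) (outB P (orbF b ε x))) :
    zvecF b x ∈ ZM (datM P A r b j₀ x) := by
  unfold ZM
  rw [mem_filter]
  refine ⟨mem_univ _, gaugeOf x (kAOf kv), ?_⟩
  have hk0 : ∀ j, anc (A j) x = {kv j} := fun j => by
    have h := hanc (fun _ => false) j
    rwa [orbF_false] at h
  have hside' : ∀ j, (sdOf b kv j = false → ∀ i, kAOf kv j + r < b i) ∧
      (sdOf b kv j = true → ∀ i, b i + 1 ≤ kAOf kv j) := by
    intro j
    constructor
    · intro hf i
      have hn : ¬ ∀ i, b i + 1 ≤ (kv j).val := by simpa [sdOf] using hf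
      rcases hside j with h | h
      · exact h i
      · exact absurd h hn
    · intro ht i
      have hy : ∀ i, b i + 1 ≤ (kv j).val := by simpa [sdOf] using ht
      exact hy i
  have hdev' : ∀ ε, ∀ q ∈ dev P (orbF b ε x),
      kAOf kv (JOf r kv j₀ q) ≤ q.val ∧ q.val ≤ kAOf kv (JOf r kv j₀ q) + r :=
    fun ε q hq => JOf_spec j₀ (hnear ε q hq)
  have hsub : ∀ ε, dev P (orbF b ε x) ⊆ winU r kv := fun ε q hq => mem_winU.2 (hnear ε q hq)
  have hg := gauge_orbit_avoids hN P x hx hb hbN (kAOf kv) (sdOf b kv) r hside' (JOf r kv j₀) hdev' hwin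
  intro ε
  have hval : datM P A r b j₀ x (gaugeOf x (kAOf kv)) ε =
      thirdVal (dev P (orbF b ε x)) (wG x (kAOf kv) (sdOf b kv) (JOf r kv j₀)) := by
    show TU P A r b j₀ (gaugeOf x (kAOf kv)) ε x = _
    rw [TU_apply P A r b j₀ _ ε x hk0, VU_apply P r b kv _ j₀ _ ε x (hsub ε), wG_eq_wTab]
    rfl
  rw [hval]
  exact hg ε

/-- the abstract big-class count at general `F`: compatible sets of size `≤ CM`, equidistribution up to `η`. -/
theorem card_big_leF {Δ : Type*} [Fintype Δ] [DecidableEq Δ] (dat : (Fin N → Bool) → Δ)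
    (Z : Δ → Finset (Fin F → Bool)) (CM : ℕ) (hZ : ∀ δ, (Z δ).card ≤ CM)
    (zv : (Fin N → Bool) → (Fin F → Bool)) (O : (Fin N → Bool) → Prop) [DecidablePred O] (η : ℕ)
    (hequi : ∀ δ z₀, 2 ^ (F + 1) * (univ.filter fun x => O x ∧ dat x = δ ∧ zv x = z₀).card ≤
      (univ.filter fun x => dat x = δ).card + 2 ^ (F + 1) * η) :
    2 ^ (F + 1) * (univ.filter fun x => O x ∧ zv x ∈ Z (dat x)).card ≤
      CM * Fintype.card (Fin N → Bool) + 2 ^ (F + 1) * CM * Fintype.card Δ * η := by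
  have hsub : (univ.filter fun x => O x ∧ zv x ∈ Z (dat x)) ⊆
      univ.biUnion fun δ => (Z δ).biUnion fun z₀ => univ.filter fun x => O x ∧ dat x = δ ∧ zv x = z₀ := by
    intro x hx
    rw [mem_filter] at hx
    rw [mem_biUnion]
    refine ⟨dat x, mem_univ _, ?_⟩
    rw [mem_biUnion]
    exact ⟨zv x, hx.2.2, mem_filter.2 ⟨mem_univ _, hx.2.1, rfl, rfl⟩⟩
  have h1 := card_le_card hsub
  have h2 : (univ.biUnion fun δ => (Z δ).biUnion fun z₀ =>
      univ.filter fun x : Fin N → Bool => O x ∧ dat x = δ ∧ zv x = z₀).card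
      ≤ ∑ δ, ∑ z₀ ∈ Z δ, (univ.filter fun x : Fin N → Bool => O x ∧ dat x = δ ∧ zv x = z₀).card :=
    card_biUnion_le.trans (sum_le_sum fun δ _ => card_biUnion_le)
  have h3 : ∀ δ, 2 ^ (F + 1) * ∑ z₀ ∈ Z δ, (univ.filter fun x : Fin N → Bool => O x ∧ dat x = δ ∧ zv x = z₀).card
      ≤ CM * ((univ.filter fun x : Fin N → Bool => dat x = δ).card + 2 ^ (F + 1) * η) := by
    intro δ
    rw [mul_sum]
    calc ∑ z₀ ∈ Z δ, 2 ^ (F + 1) * (univ.filter fun x : Fin N → Bool => O x ∧ dat x = δ ∧ zv x = z₀).card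
        ≤ ∑ z₀ ∈ Z δ, ((univ.filter fun x : Fin N → Bool => dat x = δ).card + 2 ^ (F + 1) * η) :=
          sum_le_sum fun z₀ _ => hequi δ z₀
      _ = (Z δ).card * ((univ.filter fun x : Fin N → Bool => dat x = δ).card + 2 ^ (F + 1) * η) := by
          rw [sum_const, smul_eq_mul]
      _ ≤ CM * ((univ.filter fun x : Fin N → Bool => dat x = δ).card + 2 ^ (F + 1) * η) :=
          Nat.mul_le_mul_right _ (hZ δ)
  have h4 : ∑ δ : Δ, (univ.filter fun x : Fin N → Bool => dat x = δ).card ≤ Fintype.card (Fin N → Bool) := by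
    rw [sum_card_fiberwise_eq_card_filter]
    exact card_le_univ _
  have h5 : 2 ^ (F + 1) * ∑ δ, ∑ z₀ ∈ Z δ, (univ.filter fun x : Fin N → Bool => O x ∧ dat x = δ ∧ zv x = z₀).card
      ≤ CM * Fintype.card (Fin N → Bool) + 2 ^ (F + 1) * CM * Fintype.card Δ * η := by
    rw [mul_sum]
    calc ∑ δ, 2 ^ (F + 1) * ∑ z₀ ∈ Z δ, (univ.filter fun x : Fin N → Bool => O x ∧ dat x = δ ∧ zv x = z₀).card
        ≤ ∑ δ : Δ, CM * ((univ.filter fun x : Fin N → Bool => dat x = δ).card + 2 ^ (F + 1) * η) :=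
          sum_le_sum fun δ _ => h3 δ
      _ = CM * ∑ δ : Δ, (univ.filter fun x : Fin N → Bool => dat x = δ).card
            + 2 ^ (F + 1) * CM * Fintype.card Δ * η := by
          rw [← mul_sum, sum_add_distrib, sum_const, smul_eq_mul, card_univ]; ring
      _ ≤ CM * Fintype.card (Fin N → Bool) + 2 ^ (F + 1) * CM * Fintype.card Δ * η :=
          Nat.add_le_add_right (Nat.mul_le_mul_left _ h4) _
  exact le_trans (Nat.mul_le_mul_left _ (h1.trans h2)) h5

/-- **THE COUNTING SHELL for `m` anchors** (all constants explicit).  At `F` admissible flip sites and under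
site-parity equidistribution on the datum classes (`hequi`):
`2^{F+1}·#odd ≤ CM·2^N + 2^{F+1}·CM·|Δ|·η + 2^{F+1}·(2^F·LOSE + UNI + 2^F·INST + SITE + 2^F·NN)`,
`CM = 6^m(1+F+C(F,2))`; LOSE = odd losers, UNI / INST / NN = the (UNIQ) / (STAB at the sites) / (NEAR) exceptional
masses of `MAnchorable`, SITE = odd inputs with an anchor straddling the flip region. -/
theorem count_shellM (hN : 3 ≤ N) (hF : 4 ≤ F) (j₀ : Fin m) (P : Fin N → CubeFn (ZMod 3) N)
    (A : Fin m → Fin N → CubeFn (ZMod 3) N) (r : ℕ) {b : Fin F → ℕ}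
    (hb : ∀ i j : Fin F, i < j → b i + 2 ≤ b j) (hbN : ∀ i, b i + 3 ≤ N) (η : ℕ)
    (hequi : ∀ δ z₀, 2 ^ (F + 1) * (univ.filter fun x : Fin N → Bool =>
        OddZeros x ∧ datM P A r b j₀ x = δ ∧ zvecF b x = z₀).card ≤
      (univ.filter fun x : Fin N → Bool => datM P A r b j₀ x = δ).card + 2 ^ (F + 1) * η) :
    2 ^ (F + 1) * (univ.filter fun x : Fin N → Bool => OddZeros x).card ≤
      6 ^ m * (1 + F + F.choose 2) * 2 ^ N
      + 2 ^ (F + 1) * (6 ^ m * (1 + F + F.choose 2))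
          * Fintype.card ((Fin m → ZMod 3 × Bool) → (Fin F → Bool) → ZMod 3) * η
      + 2 ^ (F + 1) * (2 ^ F * (univ.filter fun y : Fin N → Bool => OddZeros y ∧ ¬ Rel y (outB P y)).card
          + ∑ j, (univ.filter fun x : Fin N → Bool =>
              OddZeros x ∧ (univ.filter fun k : Fin N => A j k x = 1).card ≠ 1).card
          + 2 ^ F * ∑ j, ∑ i, (univ.filter fun y : Fin N → Bool => OddZeros y ∧ UBP (A j) (b i) y).card
          + ∑ j, (univ.filter fun x : Fin N → Bool => OddZeros x ∧
              ∃ k, anc (A j) x = {k} ∧ ¬ ((∀ i, k.val + r < b i) ∨ (∀ i, b i + 1 ≤ k.val))).card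
          + 2 ^ F * (univ.filter fun y : Fin N → Bool => OddZeros y ∧
              ¬ ∃ kv : Fin m → Fin N, (∀ j, A j (kv j) y = 1) ∧
                ∀ q ∈ dev P y, ∃ j, (kv j).val ≤ q.val ∧ q.val ≤ (kv j).val + r).card) := by
  have hbig := card_big_leF (datM P A r b j₀) ZM (6 ^ m * (1 + F + F.choose 2)) (fun δ => card_ZM_le hF δ)
    (zvecF b) OddZeros η hequi
  have h2N : Fintype.card (Fin N → Bool) = 2 ^ N := by
    rw [Fintype.card_fun, Fintype.card_bool, Fintype.card_fin]
  rw [h2N] at hbig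
  have h2F : (univ : Finset (Fin F → Bool)).card = 2 ^ F := by
    rw [card_univ, Fintype.card_fun, Fintype.card_bool, Fintype.card_fin]
  -- the cover of the odd class
  have hcover : (univ.filter fun x : Fin N → Bool => OddZeros x) ⊆
      (univ.filter fun x : Fin N → Bool => OddZeros x ∧ zvecF b x ∈ ZM (datM P A r b j₀ x))
      ∪ (univ.filter fun x : Fin N → Bool => OddZeros x ∧ ∃ ε, ¬ Rel (orbF b ε x) (outB P (orbF b ε x)))
      ∪ (univ.filter fun x : Fin N → Bool => OddZeros x ∧ ∃ j, (univ.filter fun k : Fin N => A j k x = 1).card ≠ 1)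
      ∪ (univ.filter fun x : Fin N → Bool => OddZeros x ∧ ∃ j ε, anc (A j) (orbF b ε x) ≠ anc (A j) x)
      ∪ (univ.filter fun x : Fin N → Bool => OddZeros x ∧
          ∃ j k, anc (A j) x = {k} ∧ ¬ ((∀ i, k.val + r < b i) ∨ (∀ i, b i + 1 ≤ k.val)))
      ∪ (univ.filter fun x : Fin N → Bool => OddZeros x ∧ ∃ ε, ¬ ∃ kv : Fin m → Fin N,
          (∀ j, A j (kv j) (orbF b ε x) = 1) ∧
            ∀ q ∈ dev P (orbF b ε x), ∃ j, (kv j).val ≤ q.val ∧ q.val ≤ (kv j).val + r) := by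
    intro x hx
    rw [mem_filter] at hx
    have hodd := hx.2
    simp only [mem_union]
    by_cases h1 : ∃ ε, ¬ Rel (orbF b ε x) (outB P (orbF b ε x))
    · exact Or.inl (Or.inl (Or.inl (Or.inl (Or.inr (mem_filter.2 ⟨mem_univ _, hodd, h1⟩)))))
    by_cases h2 : ∃ j, (univ.filter fun k : Fin N => A j k x = 1).card ≠ 1
    · exact Or.inl (Or.inl (Or.inl (Or.inr (mem_filter.2 ⟨mem_univ _, hodd, h2⟩))))
    by_cases h3 : ∃ j ε, anc (A j) (orbF b ε x) ≠ anc (A j) x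
    · exact Or.inl (Or.inl (Or.inr (mem_filter.2 ⟨mem_univ _, hodd, h3⟩)))
    by_cases h4 : ∃ j k, anc (A j) x = {k} ∧ ¬ ((∀ i, k.val + r < b i) ∨ (∀ i, b i + 1 ≤ k.val))
    · exact Or.inl (Or.inr (mem_filter.2 ⟨mem_univ _, hodd, h4⟩))
    by_cases h5 : ∃ ε, ¬ ∃ kv : Fin m → Fin N, (∀ j, A j (kv j) (orbF b ε x) = 1) ∧
        ∀ q ∈ dev P (orbF b ε x), ∃ j, (kv j).val ≤ q.val ∧ q.val ≤ (kv j).val + r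
    · exact Or.inr (mem_filter.2 ⟨mem_univ _, hodd, h5⟩)
    push Not at h1 h2 h3 h4 h5
    have hkv : ∀ j, ∃ k, anc (A j) x = {k} := fun j => Finset.card_eq_one.1 (h2 j)
    choose kv hkv using hkv
    refine Or.inl (Or.inl (Or.inl (Or.inl (Or.inl (mem_filter.2 ⟨mem_univ _, hodd, ?_⟩)))))
    refine full_memM hN j₀ P A r hb hbN x hodd kv (fun ε j => by rw [h3 j ε, hkv j]) (fun j => h4 j (kv j) (hkv j))
      (fun ε q hq => ?_) h1
    obtain ⟨kv', hA', hnear'⟩ := h5 ε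
    have hkk : kv' = kv := funext fun j => by
      have hm' : kv' j ∈ anc (A j) (orbF b ε x) := by
        unfold anc; rw [mem_filter]; exact ⟨mem_univ _, hA' j⟩
      rw [h3 j ε, hkv j, mem_singleton] at hm'
      exact hm'
    rw [← hkk]
    exact hnear' q hq
  -- the five junk cards
  have hL1 : (univ.filter fun x : Fin N → Bool =>
      OddZeros x ∧ ∃ ε, ¬ Rel (orbF b ε x) (outB P (orbF b ε x))).card ≤
      2 ^ F * (univ.filter fun y : Fin N → Bool => OddZeros y ∧ ¬ Rel y (outB P y)).card := by
    have hsub : (univ.filter fun x : Fin N → Bool =>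
        OddZeros x ∧ ∃ ε, ¬ Rel (orbF b ε x) (outB P (orbF b ε x))) ⊆
        univ.biUnion fun ε : Fin F → Bool => univ.filter fun x : Fin N → Bool =>
          OddZeros (orbF b ε x) ∧ ¬ Rel (orbF b ε x) (outB P (orbF b ε x)) := by
      intro x hx
      rw [mem_filter] at hx
      obtain ⟨_, hodd, ε, hε⟩ := hx
      rw [mem_biUnion]
      exact ⟨ε, mem_univ _, mem_filter.2 ⟨mem_univ _, (oddZeros_orbF hbN ε x).2 hodd, hε⟩⟩
    refine (card_le_card hsub).trans (card_biUnion_le.trans ?_)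
    rw [← h2F, ← smul_eq_mul, ← sum_const]
    exact sum_le_sum fun ε _ => le_of_eq (card_filter_orbF (fun y => OddZeros y ∧ ¬ Rel y (outB P y)) b ε)
  have hNU : (univ.filter fun x : Fin N → Bool =>
      OddZeros x ∧ ∃ j, (univ.filter fun k : Fin N => A j k x = 1).card ≠ 1).card ≤
      ∑ j, (univ.filter fun x : Fin N → Bool =>
        OddZeros x ∧ (univ.filter fun k : Fin N => A j k x = 1).card ≠ 1).card := by
    refine le_trans (card_le_card fun x hx => ?_) card_biUnion_le
    rw [mem_filter] at hx
    obtain ⟨_, hodd, j, hj⟩ := hx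
    rw [mem_biUnion]
    exact ⟨j, mem_univ _, mem_filter.2 ⟨mem_univ _, hodd, hj⟩⟩
  have hUS : (univ.filter fun x : Fin N → Bool =>
      OddZeros x ∧ ∃ j ε, anc (A j) (orbF b ε x) ≠ anc (A j) x).card ≤
      2 ^ F * ∑ j, ∑ i, (univ.filter fun y : Fin N → Bool => OddZeros y ∧ UBP (A j) (b i) y).card := by
    have hsub : (univ.filter fun x : Fin N → Bool =>
        OddZeros x ∧ ∃ j ε, anc (A j) (orbF b ε x) ≠ anc (A j) x) ⊆
        univ.biUnion fun j => univ.filter fun x : Fin N → Bool =>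
          OddZeros x ∧ ∃ ε, anc (A j) (orbF b ε x) ≠ anc (A j) x := by
      intro x hx
      rw [mem_filter] at hx
      obtain ⟨_, hodd, j, hj⟩ := hx
      rw [mem_biUnion]
      exact ⟨j, mem_univ _, mem_filter.2 ⟨mem_univ _, hodd, hj⟩⟩
    refine (card_le_card hsub).trans (card_biUnion_le.trans ?_)
    rw [mul_sum]
    exact sum_le_sum fun j _ => card_anc_change_le (A j) b hbN
  have hST : (univ.filter fun x : Fin N → Bool => OddZeros x ∧
      ∃ j k, anc (A j) x = {k} ∧ ¬ ((∀ i, k.val + r < b i) ∨ (∀ i, b i + 1 ≤ k.val))).card ≤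
      ∑ j, (univ.filter fun x : Fin N → Bool => OddZeros x ∧
        ∃ k, anc (A j) x = {k} ∧ ¬ ((∀ i, k.val + r < b i) ∨ (∀ i, b i + 1 ≤ k.val))).card := by
    refine le_trans (card_le_card fun x hx => ?_) card_biUnion_le
    rw [mem_filter] at hx
    obtain ⟨_, hodd, j, hj⟩ := hx
    rw [mem_biUnion]
    exact ⟨j, mem_univ _, mem_filter.2 ⟨mem_univ _, hodd, hj⟩⟩
  have hNN : (univ.filter fun x : Fin N → Bool => OddZeros x ∧ ∃ ε, ¬ ∃ kv : Fin m → Fin N,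
      (∀ j, A j (kv j) (orbF b ε x) = 1) ∧
        ∀ q ∈ dev P (orbF b ε x), ∃ j, (kv j).val ≤ q.val ∧ q.val ≤ (kv j).val + r).card ≤
      2 ^ F * (univ.filter fun y : Fin N → Bool => OddZeros y ∧
        ¬ ∃ kv : Fin m → Fin N, (∀ j, A j (kv j) y = 1) ∧
          ∀ q ∈ dev P y, ∃ j, (kv j).val ≤ q.val ∧ q.val ≤ (kv j).val + r).card := by
    have hsub : (univ.filter fun x : Fin N → Bool => OddZeros x ∧ ∃ ε, ¬ ∃ kv : Fin m → Fin N,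
        (∀ j, A j (kv j) (orbF b ε x) = 1) ∧
          ∀ q ∈ dev P (orbF b ε x), ∃ j, (kv j).val ≤ q.val ∧ q.val ≤ (kv j).val + r) ⊆
        univ.biUnion fun ε : Fin F → Bool => univ.filter fun x : Fin N → Bool =>
          OddZeros (orbF b ε x) ∧ ¬ ∃ kv : Fin m → Fin N, (∀ j, A j (kv j) (orbF b ε x) = 1) ∧
            ∀ q ∈ dev P (orbF b ε x), ∃ j, (kv j).val ≤ q.val ∧ q.val ≤ (kv j).val + r := by
      intro x hx
      rw [mem_filter] at hx
      obtain ⟨_, hodd, ε, hε⟩ := hx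
      rw [mem_biUnion]
      exact ⟨ε, mem_univ _, mem_filter.2 ⟨mem_univ _, (oddZeros_orbF hbN ε x).2 hodd, hε⟩⟩
    refine (card_le_card hsub).trans (card_biUnion_le.trans ?_)
    rw [← h2F, ← smul_eq_mul, ← sum_const]
    exact sum_le_sum fun ε _ => le_of_eq (card_filter_orbF (fun y => OddZeros y ∧
      ¬ ∃ kv : Fin m → Fin N, (∀ j, A j (kv j) y = 1) ∧
        ∀ q ∈ dev P y, ∃ j, (kv j).val ≤ q.val ∧ q.val ≤ (kv j).val + r) b ε)
  -- assemble
  have hodd := (card_le_card hcover).trans ((card_union_le _ _).trans (Nat.add_le_add_right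
    ((card_union_le _ _).trans (Nat.add_le_add_right ((card_union_le _ _).trans (Nat.add_le_add_right
      ((card_union_le _ _).trans (Nat.add_le_add_right (card_union_le _ _) _)) _)) _)) _))
  have hjunk := Nat.add_le_add (Nat.add_le_add (Nat.add_le_add (Nat.add_le_add hL1 hNU) hUS) hST) hNN
  calc 2 ^ (F + 1) * (univ.filter fun x : Fin N → Bool => OddZeros x).card
      ≤ 2 ^ (F + 1) * ((univ.filter fun x : Fin N → Bool => OddZeros x ∧ zvecF b x ∈ ZM (datM P A r b j₀ x)).card
          + ((univ.filter fun x : Fin N → Bool =>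
              OddZeros x ∧ ∃ ε, ¬ Rel (orbF b ε x) (outB P (orbF b ε x))).card
            + (univ.filter fun x : Fin N → Bool =>
              OddZeros x ∧ ∃ j, (univ.filter fun k : Fin N => A j k x = 1).card ≠ 1).card
            + (univ.filter fun x : Fin N → Bool =>
              OddZeros x ∧ ∃ j ε, anc (A j) (orbF b ε x) ≠ anc (A j) x).card
            + (univ.filter fun x : Fin N → Bool => OddZeros x ∧
              ∃ j k, anc (A j) x = {k} ∧ ¬ ((∀ i, k.val + r < b i) ∨ (∀ i, b i + 1 ≤ k.val))).card
            + (univ.filter fun x : Fin N → Bool => OddZeros x ∧ ∃ ε, ¬ ∃ kv : Fin m → Fin N,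
              (∀ j, A j (kv j) (orbF b ε x) = 1) ∧
                ∀ q ∈ dev P (orbF b ε x), ∃ j, (kv j).val ≤ q.val ∧ q.val ≤ (kv j).val + r).card)) := by
        refine Nat.mul_le_mul_left _ ?_
        omega
    _ = 2 ^ (F + 1) * (univ.filter fun x : Fin N → Bool => OddZeros x ∧ zvecF b x ∈ ZM (datM P A r b j₀ x)).card
          + 2 ^ (F + 1) * ((univ.filter fun x : Fin N → Bool =>
              OddZeros x ∧ ∃ ε, ¬ Rel (orbF b ε x) (outB P (orbF b ε x))).card
            + (univ.filter fun x : Fin N → Bool =>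
              OddZeros x ∧ ∃ j, (univ.filter fun k : Fin N => A j k x = 1).card ≠ 1).card
            + (univ.filter fun x : Fin N → Bool =>
              OddZeros x ∧ ∃ j ε, anc (A j) (orbF b ε x) ≠ anc (A j) x).card
            + (univ.filter fun x : Fin N → Bool => OddZeros x ∧
              ∃ j k, anc (A j) x = {k} ∧ ¬ ((∀ i, k.val + r < b i) ∨ (∀ i, b i + 1 ≤ k.val))).card
            + (univ.filter fun x : Fin N → Bool => OddZeros x ∧ ∃ ε, ¬ ∃ kv : Fin m → Fin N,
              (∀ j, A j (kv j) (orbF b ε x) = 1) ∧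
                ∀ q ∈ dev P (orbF b ε x), ∃ j, (kv j).val ≤ q.val ∧ q.val ≤ (kv j).val + r).card) := by
        rw [Nat.mul_add]
    _ ≤ _ := Nat.add_le_add hbig (Nat.mul_le_mul_left _ hjunk)

end ShellM

end Summit.QuantumAdvantage.QuantumAdvantage.Theorems.AnchorDial

end
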